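import Summits.QuantumFields.YangMills.Theorems.SamplerStabilityUnitSamplerGapEfronStein

/-!
# The perturbed Efron–Stein inequality on a finite product of copies of a probability space
# (helper for crux `UnitSamplerGap`, stmt-QuantumFields-28042, route `SamplerStability`, LINE 11 «holley_stroock»)

Route-independent helper file (no definitions).  If `μ = u · ρ^{⊗ι}` is a probability measure on `ι → X` with `u`
measurable and `e^{-b} ≤ u ≤ e^{b}`, then for every `g ∈ L²(μ)`

  `∫ g² dμ − (∫ g dμ)² ≤ e^{2b} Σ_i (∫ g² dμ − ∫ (μ[g | σ(ω_b, b ≠ i)])² dμ)`        (★ `var_le_exp_mul_sum`)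

— the single-coordinate heat-bath (Gibbs-sampler) Poincaré inequality with constant `e^{2b}`.  Proof: Holley–Stroock for
the variance (`var_le_exp_mul_var`: `μ ≤ e^{b} π` ⇒ `Var_μ ≤ e^{b} Var_π`, the variance being the minimum over constants of
`∫ (g − c)²`), Efron–Stein in conditional form under `π = ρ^{⊗ι}` (`variance_pi_le_sum_condVar`), and Holley–Stroock for
each heat-bath term (`condVar_integral_le_exp_mul`: `π ≤ e^{b} μ`); the two measure comparisons are
`le_exp_smul_of_density_le` / `le_exp_smul_of_exp_neg_le_density`; a general `g ∈ L²(μ)` is replaced by a strongly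
measurable version (`var_le_exp_mul_sum_of_stronglyMeasurable` → `var_le_exp_mul_sum`).

Cell `ym-idea-1` width seat `ym-line-sfw-p2-w3` g29 (free hands), following planner ym-idea-5 g15's LANDABLE-NOW-g15 §4.5.
HONEST FRAMING: helper lemmas only; no crux, rung or summit is proved; the YM mass gap is NOT proved.
-/

noncomputable section

open MeasureTheory ProbabilityTheory Filter Set Function
open scoped ENNReal

namespace Summit.QuantumFields.YangMills.Theorems.UnitSamplerGap

/-! ### §3 Holley–Stroock comparison for a two-sided bounded density -/

section HolleyStroock

variable {Ω : Type*} [MeasurableSpace Ω] {π μ : Measure Ω} {b : ℝ} {u : Ω → ℝ}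

/-- If `μ = u · π` with `u ≤ e^{b}` then `μ ≤ e^{b} π`. [folklore] -/
theorem le_exp_smul_of_density_le (hbd : ∀ ω, u ω ≤ Real.exp b)
    (hμ : μ = π.withDensity (fun ω => ENNReal.ofReal (u ω))) :
    μ ≤ ENNReal.ofReal (Real.exp b) • π := by
  refine Measure.le_iff.2 fun s hs => ?_
  rw [hμ, withDensity_apply _ hs, Measure.smul_apply, smul_eq_mul]
  calc ∫⁻ ω in s, ENNReal.ofReal (u ω) ∂π ≤ ∫⁻ _ in s, ENNReal.ofReal (Real.exp b) ∂π :=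
        lintegral_mono fun ω => ENNReal.ofReal_le_ofReal (hbd ω)
    _ = ENNReal.ofReal (Real.exp b) * π s := setLIntegral_const _ _

/-- If `μ = u · π` with `u` measurable and `e^{-b} ≤ u` then `π ≤ e^{b} μ`. [folklore] -/
theorem le_exp_smul_of_exp_neg_le_density (hu : Measurable u) (hbd : ∀ ω, Real.exp (-b) ≤ u ω)
    (hμ : μ = π.withDensity (fun ω => ENNReal.ofReal (u ω))) :
    π ≤ ENNReal.ofReal (Real.exp b) • μ := by
  refine Measure.le_iff.2 fun s hs => ?_
  rw [hμ, Measure.smul_apply, smul_eq_mul, withDensity_apply _ hs,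
    ← lintegral_const_mul _ hu.ennreal_ofReal]
  have hpt : ∀ ω, (1 : ℝ≥0∞) ≤ ENNReal.ofReal (Real.exp b) * ENNReal.ofReal (u ω) := by
    intro ω
    rw [← ENNReal.ofReal_mul (Real.exp_pos b).le, ← ENNReal.ofReal_one]
    refine ENNReal.ofReal_le_ofReal ?_
    have h1 : Real.exp b * Real.exp (-b) = 1 := by rw [← Real.exp_add, add_neg_cancel, Real.exp_zero]
    calc (1 : ℝ) = Real.exp b * Real.exp (-b) := h1.symm
      _ ≤ Real.exp b * u ω := mul_le_mul_of_nonneg_left (hbd ω) (Real.exp_pos b).le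
  calc π s = ∫⁻ _ in s, (1 : ℝ≥0∞) ∂π := by rw [setLIntegral_const, one_mul]
    _ ≤ ∫⁻ ω in s, ENNReal.ofReal (Real.exp b) * ENNReal.ofReal (u ω) ∂π := lintegral_mono fun ω => hpt ω

variable [IsProbabilityMeasure π] [IsProbabilityMeasure μ]

/-- **Holley–Stroock for the variance**: if `μ ≤ e^{b} π` (both probability measures) then
`Var_μ(g) ≤ e^{b} Var_π(g)` for `g ∈ L²(μ) ∩ L²(π)` — the variance is the minimum over constants `c` of
`∫ (g − c)²`, and `∫ (g − c)² dμ ≤ e^{b} ∫ (g − c)² dπ`. [cite: HolleyStroock1987, Lemma (bounded perturbation)] -/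
theorem var_le_exp_mul_var (hle : μ ≤ ENNReal.ofReal (Real.exp b) • π) {g : Ω → ℝ}
    (hgμ : MemLp g 2 μ) (hgπ : MemLp g 2 π) :
    (∫ ω, g ω ^ 2 ∂μ) - (∫ ω, g ω ∂μ) ^ 2
      ≤ Real.exp b * ((∫ ω, g ω ^ 2 ∂π) - (∫ ω, g ω ∂π) ^ 2) := by
  set c : ℝ := ∫ ω, g ω ∂π with hc
  -- `∫ (g − c)² dν = ∫ g² dν − 2c ∫ g dν + c²` for a probability measure `ν` with `g ∈ L²(ν)`
  have expand : ∀ (ν : Measure Ω) [IsProbabilityMeasure ν], MemLp g 2 ν →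
      ∫ ω, (g ω - c) ^ 2 ∂ν = (∫ ω, g ω ^ 2 ∂ν) - 2 * c * (∫ ω, g ω ∂ν) + c ^ 2 := by
    intro ν _ hgν
    have hgi : Integrable g ν := hgν.integrable one_le_two
    have hg2 : Integrable (fun ω => g ω ^ 2) ν := hgν.integrable_sq
    have hsplit : (fun ω => (g ω - c) ^ 2) = fun ω => (g ω ^ 2 - 2 * c * g ω) + c ^ 2 := by
      funext ω; ring
    have hI : Integrable (fun ω => g ω ^ 2 - 2 * c * g ω) ν := hg2.sub (hgi.const_mul _)
    rw [hsplit, integral_add hI (integrable_const _), integral_sub hg2 (hgi.const_mul _), integral_const_mul,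
      integral_const, smul_eq_mul, probReal_univ, one_mul]
  have hμc : (∫ ω, g ω ^ 2 ∂μ) - (∫ ω, g ω ∂μ) ^ 2 ≤ ∫ ω, (g ω - c) ^ 2 ∂μ := by
    rw [expand μ hgμ]
    nlinarith [sq_nonneg ((∫ ω, g ω ∂μ) - c)]
  have hπc : ∫ ω, (g ω - c) ^ 2 ∂π = (∫ ω, g ω ^ 2 ∂π) - (∫ ω, g ω ∂π) ^ 2 := by
    rw [expand π hgπ, ← hc]; ring
  have hcmp : ∫ ω, (g ω - c) ^ 2 ∂μ ≤ Real.exp b * ∫ ω, (g ω - c) ^ 2 ∂π :=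
    integral_le_exp_mul_integral_of_le_smul hle (fun ω => sq_nonneg _) (hgπ.sub (memLp_const c)).integrable_sq
  calc (∫ ω, g ω ^ 2 ∂μ) - (∫ ω, g ω ∂μ) ^ 2 ≤ ∫ ω, (g ω - c) ^ 2 ∂μ := hμc
    _ ≤ Real.exp b * ∫ ω, (g ω - c) ^ 2 ∂π := hcmp
    _ = Real.exp b * ((∫ ω, g ω ^ 2 ∂π) - (∫ ω, g ω ∂π) ^ 2) := by rw [hπc]

end HolleyStroock

/-! ### §4 The perturbed Efron–Stein inequality on `ρ^{⊗ι}` -/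

section Main

variable {ι : Type*} [Fintype ι] {X : Type*} [MeasurableSpace X] (ρ : Measure X) [IsProbabilityMeasure ρ]

/-- **Perturbed Efron–Stein on a finite product of copies of a probability space** (Efron–Stein for `ρ^{⊗ι}` in
conditional-variance form + Holley–Stroock comparison, factor `e^{b}` twice): if `μ = u · ρ^{⊗ι}` is a probability
measure with `u` measurable and `e^{-b} ≤ u ≤ e^{b}`, then for every STRONGLY MEASURABLE `g ∈ L²(μ)`
`∫ g² dμ − (∫ g dμ)² ≤ e^{2b} Σ_i (∫ g² dμ − ∫ (μ[g | σ(ω_b, b ≠ i)])² dμ)`.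
[cite: BoucheronBousquetLugosi2004, §2 Thm 4] [cite: HolleyStroock1987, Lemma (bounded perturbation)] -/
theorem var_le_exp_mul_sum_of_stronglyMeasurable (μ : Measure (ι → X)) [IsProbabilityMeasure μ] (b : ℝ)
    (u : (ι → X) → ℝ) (hu : Measurable u) (hbd : ∀ V, Real.exp (-b) ≤ u V ∧ u V ≤ Real.exp b)
    (hμ : μ = (Measure.pi fun _ : ι => ρ).withDensity (fun V => ENNReal.ofReal (u V)))
    {g : (ι → X) → ℝ} (hgm : StronglyMeasurable g) (hg : MemLp g 2 μ) :
    (∫ V, g V ^ 2 ∂μ) - (∫ V, g V ∂μ) ^ 2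
      ≤ Real.exp (2 * b) * ∑ i : ι, ((∫ V, g V ^ 2 ∂μ)
        - ∫ V, (μ[g | MeasurableSpace.comap (fun (ω : ι → X) (b : {b : ι // b ≠ i}) => ω b.1)
            MeasurableSpace.pi]) V ^ 2 ∂μ) := by
  classical
  set π : Measure (ι → X) := Measure.pi fun _ : ι => ρ with hπ
  have hle1 : μ ≤ ENNReal.ofReal (Real.exp b) • π := le_exp_smul_of_density_le (fun V => (hbd V).2) hμ
  have hle2 : π ≤ ENNReal.ofReal (Real.exp b) • μ :=
    le_exp_smul_of_exp_neg_le_density hu (fun V => (hbd V).1) hμ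
  have hgπ : MemLp g 2 π := hg.of_measure_le_smul ENNReal.ofReal_ne_top hle2
  have hb0 : 0 ≤ Real.exp b := (Real.exp_pos b).le
  -- Holley–Stroock for the variance, then Efron–Stein under `π`, then Holley–Stroock termwise
  have h1 := var_le_exp_mul_var hle1 hg hgπ
  have h2 : (∫ V, g V ^ 2 ∂π) - (∫ V, g V ∂π) ^ 2 ≤ ∑ i : ι, ((∫ V, g V ^ 2 ∂π)
      - ∫ V, (π[g | MeasurableSpace.comap (fun (ω : ι → X) (b : {b : ι // b ≠ i}) => ω b.1)
          MeasurableSpace.pi]) V ^ 2 ∂π) := by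
    have hv := variance_pi_le_sum_condVar ρ hgm hgπ
    have hvar : variance g π = (∫ V, g V ^ 2 ∂π) - (∫ V, g V ∂π) ^ 2 := by
      rw [variance_eq_sub hgπ]; rfl
    rw [← hvar]; exact hv
  have h3 : ∀ i : ι, (∫ V, g V ^ 2 ∂π)
      - ∫ V, (π[g | MeasurableSpace.comap (fun (ω : ι → X) (b : {b : ι // b ≠ i}) => ω b.1)
          MeasurableSpace.pi]) V ^ 2 ∂π
      ≤ Real.exp b * ((∫ V, g V ^ 2 ∂μ)
        - ∫ V, (μ[g | MeasurableSpace.comap (fun (ω : ι → X) (b : {b : ι // b ≠ i}) => ω b.1)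
            MeasurableSpace.pi]) V ^ 2 ∂μ) :=
    fun i => condVar_integral_le_exp_mul (comap_restrict_le (X := X) i) hle2 hg hgπ
  calc (∫ V, g V ^ 2 ∂μ) - (∫ V, g V ∂μ) ^ 2
      ≤ Real.exp b * ((∫ V, g V ^ 2 ∂π) - (∫ V, g V ∂π) ^ 2) := h1
    _ ≤ Real.exp b * ∑ i : ι, Real.exp b * ((∫ V, g V ^ 2 ∂μ)
        - ∫ V, (μ[g | MeasurableSpace.comap (fun (ω : ι → X) (b : {b : ι // b ≠ i}) => ω b.1)
            MeasurableSpace.pi]) V ^ 2 ∂μ) :=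
        mul_le_mul_of_nonneg_left (h2.trans (Finset.sum_le_sum fun i _ => h3 i)) hb0
    _ = Real.exp (2 * b) * ∑ i : ι, ((∫ V, g V ^ 2 ∂μ)
        - ∫ V, (μ[g | MeasurableSpace.comap (fun (ω : ι → X) (b : {b : ι // b ≠ i}) => ω b.1)
            MeasurableSpace.pi]) V ^ 2 ∂μ) := by
        rw [← Finset.mul_sum, ← mul_assoc, ← Real.exp_add, two_mul]

/-- **Perturbed Efron–Stein on `ρ^{⊗ι}`** — the same for every `g ∈ L²(μ)` (reduction to a strongly measurable
version of `g`; all terms are invariant under `μ`-a.e. modification). [cite: BoucheronBousquetLugosi2004, §2 Thm 4]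
[cite: HolleyStroock1987, Lemma (bounded perturbation)] -/
theorem var_le_exp_mul_sum (μ : Measure (ι → X)) [IsProbabilityMeasure μ] (b : ℝ)
    (u : (ι → X) → ℝ) (hu : Measurable u) (hbd : ∀ V, Real.exp (-b) ≤ u V ∧ u V ≤ Real.exp b)
    (hμ : μ = (Measure.pi fun _ : ι => ρ).withDensity (fun V => ENNReal.ofReal (u V)))
    (g : (ι → X) → ℝ) (hg : MemLp g 2 μ) :
    (∫ V, g V ^ 2 ∂μ) - (∫ V, g V ∂μ) ^ 2
      ≤ Real.exp (2 * b) * ∑ i : ι, ((∫ V, g V ^ 2 ∂μ)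
        - ∫ V, (μ[g | MeasurableSpace.comap (fun (ω : ι → X) (b : {b : ι // b ≠ i}) => ω b.1)
            MeasurableSpace.pi]) V ^ 2 ∂μ) := by
  set g' : (ι → X) → ℝ := hg.1.mk g with hg'def
  have hg'm : StronglyMeasurable g' := hg.1.stronglyMeasurable_mk
  have hgg' : g =ᵐ[μ] g' := hg.1.ae_eq_mk
  have hg' : MemLp g' 2 μ := hg.ae_eq hgg'
  have e1 : ∫ V, g V ^ 2 ∂μ = ∫ V, g' V ^ 2 ∂μ :=
    integral_congr_ae (by filter_upwards [hgg'] with V hV; rw [hV])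
  have e2 : ∫ V, g V ∂μ = ∫ V, g' V ∂μ := integral_congr_ae hgg'
  have e3 : ∀ i : ι, ∫ V, (μ[g | MeasurableSpace.comap (fun (ω : ι → X) (b : {b : ι // b ≠ i}) => ω b.1)
        MeasurableSpace.pi]) V ^ 2 ∂μ
      = ∫ V, (μ[g' | MeasurableSpace.comap (fun (ω : ι → X) (b : {b : ι // b ≠ i}) => ω b.1)
        MeasurableSpace.pi]) V ^ 2 ∂μ :=
    fun i => integral_congr_ae (by filter_upwards [condExp_congr_ae (m := MeasurableSpace.comap
      (fun (ω : ι → X) (b : {b : ι // b ≠ i}) => ω b.1) MeasurableSpace.pi) hgg'] with V hV; rw [hV])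
  rw [e1, e2]
  simp only [e3]
  exact var_le_exp_mul_sum_of_stronglyMeasurable ρ μ b u hu hbd hμ hg'm hg'

end Main

end Summit.QuantumFields.YangMills.Theorems.UnitSamplerGap
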